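import Literature.InformationTheory.QuantumCodes.TwistedToricErasureHalf
import Literature.InformationTheory.QuantumCodes.RotatedToricErasureHalf
import HarnessLib

/-!
# Loss threshold EXACTLY `1/2` for twisted tori of polynomial volume — and the dilated family `[[2n²c, 2, n(2t+1)]]`

Topic `Literature/InformationTheory/QuantumCodes` (venture QEC, LADDER-QEC rung Q5; qec-type-03). All PROVED, no named fact, kernel
axioms. Two corollaries of `TwistedToric.twistedToric_loss_accuracyThreshold_eq_half` (`TwistedToricErasureHalf.lean`):

* `twistedToric_loss_accuracyThreshold_eq_half_of_systole` — the growth hypothesis in its usual form: if the groups have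
  POLYNOMIAL volume in the systole, `|G_i| ≤ A · sys₁(Λ_i)^m`, and `sys₁(Λ_i) → ∞`, then the qubit-loss accuracy threshold of the
  twisted toric codes `code (g₁ i) (g₂ i)` is EXACTLY `1/2` (every planar two-dimensional family: `|G| = Θ(d²)`);
* **`dilatedToric_loss_accuracyThreshold_eq_half`** — the unconditional instance for Kovalev–Pryadko's dilated rotated family
  (2013, Ex. 7): the codes `LP[1 + x y^{2t+1}, 1 + y]` over `ℤ_n × ℤ_{nc_t}`, `c_t = 2t² + 2t + 1`, parameters
  `[[2n²c_t, 2, n(2t+1)]]` (`dilated_isCode`; `[[40,2,6]]`, `[[90,2,9]]`, …), along ANY sequence `(n_i, t_i)` with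
  `n_i (2t_i + 1) → ∞` — in particular for fixed `t` and `n → ∞`, and for fixed `n` and `t → ∞` (`n = 1` is the rotated family
  `[[d²+1, 2, d]]` of `RotatedToricErasureHalf.lean`).

References: [KovalevPryadko2013Hyperbicycle] A. A. Kovalev, L. P. Pryadko, PRA 88 (2013) 012311, §IV Ex. 7 («[[2n²c, 2, nχ]]»);
[StaceBarrettDoherty2009] T. M. Stace, S. D. Barrett, A. C. Doherty, PRL 102 (2009) 200501, p. 1–3 (loss threshold 1/2);
[KestenCMP1980] H. Kesten, Comm. Math. Phys. 74 (1980) 41–59, Thm. 1–2.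
-/

namespace Literature.InformationTheory.QuantumCodes

namespace TwistedToric

open Finset Matrix Filter Topology

/-- `s ↦ s^m e^{-b s} → 0` along every natural sequence `s_i → ∞` (`b > 0`). [folklore] -/
private theorem tendsto_pow_mul_exp_neg_comp {s : ℕ → ℕ} (hs : Tendsto s atTop atTop) (m : ℕ) {b : ℝ} (hb : 0 < b) :
    Tendsto (fun i => (s i : ℝ) ^ m * Real.exp (-b * (s i : ℝ))) atTop (𝓝 0) := by
  have h1 : Tendsto (fun x : ℝ => x ^ m * Real.exp (-b * x)) atTop (𝓝 0) := by
    have h := ((Real.tendsto_pow_mul_exp_neg_atTop_nhds_zero m).comp (tendsto_id.const_mul_atTop hb)).const_mul (b ^ m)⁻¹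
    rw [mul_zero] at h
    refine h.congr fun x => ?_
    have hbm : (b ^ m)⁻¹ * b ^ m = 1 := inv_mul_cancel₀ (pow_ne_zero m hb.ne')
    show (b ^ m)⁻¹ * ((b * id x) ^ m * Real.exp (-(b * id x))) = x ^ m * Real.exp (-b * x)
    rw [id, mul_pow, neg_mul]
    calc (b ^ m)⁻¹ * (b ^ m * x ^ m * Real.exp (-(b * x))) = (b ^ m)⁻¹ * b ^ m * (x ^ m * Real.exp (-(b * x))) := by ring
      _ = x ^ m * Real.exp (-(b * x)) := by rw [hbm, one_mul]
  exact h1.comp (tendsto_natCast_atTop_atTop.comp hs)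

open Classical in
/-- **Polynomial volume ⇒ loss threshold EXACTLY `1/2`.** If `(g₁ i, g₂ i)` generate `G_i`, `|G_i| ≤ A · sys₁(Λ_i)^m` and
`sys₁(Λ_i) → ∞`, then the loss-uncorrectability family of the twisted toric codes `code (g₁ i) (g₂ i)` has accuracy threshold
`1/2`: the growth hypothesis `|G_i| e^{-c ⌊(sys₁ - 1)/4⌋} → 0` of `twistedToric_loss_accuracyThreshold_eq_half` holds because
`A s^m e^{c} e^{-(c/4) s} → 0`. [cite: StaceBarrettDoherty2009, p. 1 (maximum tolerable loss rate 50%), p. 3 (L → ∞)]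
[cite: KovalevPryadko2013Hyperbicycle, §IV (finite-rate planar families, distance = Manhattan systole)] -/
theorem twistedToric_loss_accuracyThreshold_eq_half_of_systole {Gs : ℕ → Type*} [∀ i, AddCommGroup (Gs i)]
    [∀ i, DecidableEq (Gs i)] [∀ i, Fintype (Gs i)] (g₁ g₂ : ∀ i, Gs i)
    (hgen : ∀ i (x : Gs i), ∃ m : ℤ × ℤ, m.1 • g₁ i + m.2 • g₂ i = x) {A : ℝ} {m : ℕ}
    (hcard : ∀ i, (Fintype.card (Gs i) : ℝ) ≤ A * (systole (g₁ i) (g₂ i) : ℝ) ^ m)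
    (hsys : Tendsto (fun i => systole (g₁ i) (g₂ i)) atTop atTop) :
    accuracyThreshold (fun i y => ErasureDecoder.uncorrectableProb
      {z : Gs i ⊕ Gs i → ZMod 2 | (code (g₁ i) (g₂ i)).HX *ᵥ z = 0}
      ((code (g₁ i) (g₂ i)).rowSpZ : Set (Gs i ⊕ Gs i → ZMod 2)) y) = 1 / 2 := by
  refine twistedToric_loss_accuracyThreshold_eq_half g₁ g₂ hgen ?_
  intro c hc
  have hA : 0 ≤ A := by
    have h := hcard 0
    have hpos : (0 : ℝ) < (systole (g₁ 0) (g₂ 0) : ℝ) ^ m := by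
      have := systole_pos (g₁ 0) (g₂ 0)
      positivity
    have h0 : (0 : ℝ) ≤ (Fintype.card (Gs 0) : ℝ) := Nat.cast_nonneg _
    by_contra hneg
    rw [not_le] at hneg
    have : A * (systole (g₁ 0) (g₂ 0) : ℝ) ^ m < 0 := mul_neg_of_neg_of_pos hneg hpos
    linarith
  have hlim := (tendsto_pow_mul_exp_neg_comp hsys m (by positivity : 0 < c / 4)).const_mul (A * Real.exp c)
  rw [mul_zero] at hlim
  refine squeeze_zero' (Eventually.of_forall fun i => by positivity) (Eventually.of_forall fun i => ?_) hlim
  have hq : (systole (g₁ i) (g₂ i) : ℝ) ≤ 4 * ((((systole (g₁ i) (g₂ i) - 1) / 4 : ℕ)) : ℝ) + 4 := by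
    have : systole (g₁ i) (g₂ i) ≤ 4 * ((systole (g₁ i) (g₂ i) - 1) / 4) + 4 := by omega
    exact_mod_cast this
  have hexp : Real.exp (-c * ((((systole (g₁ i) (g₂ i) - 1) / 4 : ℕ)) : ℝ)) ≤
      Real.exp c * Real.exp (-(c / 4) * (systole (g₁ i) (g₂ i) : ℝ)) := by
    rw [← Real.exp_add]
    apply Real.exp_le_exp.2
    nlinarith
  calc (Fintype.card (Gs i) : ℝ) * Real.exp (-c * ((((systole (g₁ i) (g₂ i) - 1) / 4 : ℕ)) : ℝ))
      ≤ (A * (systole (g₁ i) (g₂ i) : ℝ) ^ m) * (Real.exp c * Real.exp (-(c / 4) * (systole (g₁ i) (g₂ i) : ℝ))) :=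
        mul_le_mul (hcard i) hexp (by positivity) (by positivity)
    _ = A * Real.exp c * ((systole (g₁ i) (g₂ i) : ℝ) ^ m * Real.exp (-(c / 4) * (systole (g₁ i) (g₂ i) : ℝ))) := by
        ring

/-! ### The dilated rotated family `LP[1 + x y^{2t+1}, 1 + y]` over `ℤ_n × ℤ_{n c_t}` -/

/-- `sys₁(nΛ_t) = n(2t+1)` for the dilated lattice presented with `a = 2t + 1` (here with `n + 1` for `n`, so that the group is
non-trivial for every index). [cite: KovalevPryadko2013Hyperbicycle, §IV Ex. 7 (distance nχ, χ = 2t+1)] -/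
theorem dilated_systole (n t : ℕ) :
    systole ((1 : ZMod (n + 1)), ((((2 * t + 1 : ℕ) : ℤ)) : ZMod ((n + 1) * (2 * t ^ 2 + 2 * t + 1))))
      ((0 : ZMod (n + 1)), (1 : ZMod ((n + 1) * (2 * t ^ 2 + 2 * t + 1)))) = (n + 1) * (2 * t + 1) := by
  refine systole_dilated (n := n + 1) (N := (n + 1) * (2 * t ^ 2 + 2 * t + 1)) (c := 2 * t ^ 2 + 2 * t + 1) (t := t)
    (a := ((2 * t + 1 : ℕ) : ℤ)) rfl (rotated_c_eq t) ?_ ?_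
  · refine ⟨1, ?_⟩; push_cast; ring
  · refine ⟨1, ?_⟩; push_cast; ring

open Classical in
/-- ★ **Kovalev–Pryadko's dilated rotated toric codes `[[2n²c_t, 2, n(2t+1)]]` have loss threshold EXACTLY `1/2`** along every
sequence `(n_i, t_i)` with `n_i (2 t_i + 1) → ∞` (written with `n_i = ν i + 1 ≥ 1`): the accuracy threshold of the
loss-uncorrectability family of `LP[1 + x y^{2t_i+1}, 1 + y]` over `ℤ_{n_i} × ℤ_{n_i c_{t_i}}`, `c_t = 2t² + 2t + 1`, is `1/2`.
Instance of `twistedToric_loss_accuracyThreshold_eq_half_of_systole` with `|G| = n²c_t ≤ (n(2t+1))² = sys₁²`.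
[cite: KovalevPryadko2013Hyperbicycle, §IV Ex. 7 (the codes [[2n²c, 2, nχ]], [[40,2,6]], [[90,2,9]])]
[cite: StaceBarrettDoherty2009, p. 1 (maximum tolerable loss rate 50%)] -/
theorem dilatedToric_loss_accuracyThreshold_eq_half (ν τ : ℕ → ℕ)
    (h : Tendsto (fun i => (ν i + 1) * (2 * τ i + 1)) atTop atTop) :
    accuracyThreshold (fun i y => ErasureDecoder.uncorrectableProb
      {z : (ZMod (ν i + 1) × ZMod ((ν i + 1) * (2 * τ i ^ 2 + 2 * τ i + 1))) ⊕
          (ZMod (ν i + 1) × ZMod ((ν i + 1) * (2 * τ i ^ 2 + 2 * τ i + 1))) → ZMod 2 |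
        (code ((1 : ZMod (ν i + 1)), ((((2 * τ i + 1 : ℕ) : ℤ)) : ZMod ((ν i + 1) * (2 * τ i ^ 2 + 2 * τ i + 1))))
          ((0 : ZMod (ν i + 1)), (1 : ZMod ((ν i + 1) * (2 * τ i ^ 2 + 2 * τ i + 1))))).HX *ᵥ z = 0}
      ((code ((1 : ZMod (ν i + 1)), ((((2 * τ i + 1 : ℕ) : ℤ)) : ZMod ((ν i + 1) * (2 * τ i ^ 2 + 2 * τ i + 1))))
          ((0 : ZMod (ν i + 1)), (1 : ZMod ((ν i + 1) * (2 * τ i ^ 2 + 2 * τ i + 1))))).rowSpZ :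
        Set ((ZMod (ν i + 1) × ZMod ((ν i + 1) * (2 * τ i ^ 2 + 2 * τ i + 1))) ⊕
          (ZMod (ν i + 1) × ZMod ((ν i + 1) * (2 * τ i ^ 2 + 2 * τ i + 1))) → ZMod 2)) y) = 1 / 2 := by
  refine twistedToric_loss_accuracyThreshold_eq_half_of_systole
    (Gs := fun i => ZMod (ν i + 1) × ZMod ((ν i + 1) * (2 * τ i ^ 2 + 2 * τ i + 1)))
    (fun i => ((1 : ZMod (ν i + 1)), ((((2 * τ i + 1 : ℕ) : ℤ)) : ZMod ((ν i + 1) * (2 * τ i ^ 2 + 2 * τ i + 1)))))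
    (fun i => ((0 : ZMod (ν i + 1)), (1 : ZMod ((ν i + 1) * (2 * τ i ^ 2 + 2 * τ i + 1)))))
    (fun i => gen_dilated (n := ν i + 1) (N := (ν i + 1) * (2 * τ i ^ 2 + 2 * τ i + 1)) ((2 * τ i + 1 : ℕ) : ℤ))
    (A := 1) (m := 2) (fun i => ?_) ?_
  · rw [dilated_systole, Fintype.card_prod, ZMod.card, ZMod.card]
    have hle : (ν i + 1) * ((ν i + 1) * (2 * τ i ^ 2 + 2 * τ i + 1)) ≤ ((ν i + 1) * (2 * τ i + 1)) ^ 2 := by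
      have hc : 2 * τ i ^ 2 + 2 * τ i + 1 ≤ (2 * τ i + 1) ^ 2 := by nlinarith
      calc (ν i + 1) * ((ν i + 1) * (2 * τ i ^ 2 + 2 * τ i + 1)) = (ν i + 1) ^ 2 * (2 * τ i ^ 2 + 2 * τ i + 1) := by ring
        _ ≤ (ν i + 1) ^ 2 * (2 * τ i + 1) ^ 2 := Nat.mul_le_mul_left _ hc
        _ = ((ν i + 1) * (2 * τ i + 1)) ^ 2 := by ring
    have : (((ν i + 1) * ((ν i + 1) * (2 * τ i ^ 2 + 2 * τ i + 1)) : ℕ) : ℝ) ≤ ((((ν i + 1) * (2 * τ i + 1)) ^ 2 : ℕ) : ℝ) := by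
      exact_mod_cast hle
    push_cast at this ⊢
    linarith
  · have e : (fun i => systole ((1 : ZMod (ν i + 1)), ((((2 * τ i + 1 : ℕ) : ℤ)) : ZMod ((ν i + 1) * (2 * τ i ^ 2 + 2 * τ i + 1))))
        ((0 : ZMod (ν i + 1)), (1 : ZMod ((ν i + 1) * (2 * τ i ^ 2 + 2 * τ i + 1))))) = fun i => (ν i + 1) * (2 * τ i + 1) := by
      funext i; exact dilated_systole (ν i) (τ i)
    rw [e]
    exact h

open Classical in
/-- The dilated family at fixed twist `t`, `n → ∞`: loss threshold EXACTLY `1/2` for the codes `[[2n²c_t, 2, n(2t+1)]]`,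
`n = 1, 2, 3, …` (KP13 Ex. 7: `t = 1` gives `[[10n², 2, 3n]]` = `[[40,2,6]]`, `[[90,2,9]]`, …).
[cite: KovalevPryadko2013Hyperbicycle, §IV Ex. 7 ([[2n²c, 2, nχ]])] [cite: StaceBarrettDoherty2009, p. 1] -/
theorem dilatedToric_loss_accuracyThreshold_eq_half_fixed_twist (t : ℕ) :
    accuracyThreshold (fun n y => ErasureDecoder.uncorrectableProb
      {z : (ZMod (n + 1) × ZMod ((n + 1) * (2 * t ^ 2 + 2 * t + 1))) ⊕
          (ZMod (n + 1) × ZMod ((n + 1) * (2 * t ^ 2 + 2 * t + 1))) → ZMod 2 |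
        (code ((1 : ZMod (n + 1)), ((((2 * t + 1 : ℕ) : ℤ)) : ZMod ((n + 1) * (2 * t ^ 2 + 2 * t + 1))))
          ((0 : ZMod (n + 1)), (1 : ZMod ((n + 1) * (2 * t ^ 2 + 2 * t + 1))))).HX *ᵥ z = 0}
      ((code ((1 : ZMod (n + 1)), ((((2 * t + 1 : ℕ) : ℤ)) : ZMod ((n + 1) * (2 * t ^ 2 + 2 * t + 1))))
          ((0 : ZMod (n + 1)), (1 : ZMod ((n + 1) * (2 * t ^ 2 + 2 * t + 1))))).rowSpZ :
        Set ((ZMod (n + 1) × ZMod ((n + 1) * (2 * t ^ 2 + 2 * t + 1))) ⊕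
          (ZMod (n + 1) × ZMod ((n + 1) * (2 * t ^ 2 + 2 * t + 1))) → ZMod 2)) y) = 1 / 2 := by
  refine dilatedToric_loss_accuracyThreshold_eq_half (fun n => n) (fun _ => t) ?_
  refine tendsto_atTop_mono (fun n => ?_) tendsto_id
  exact le_trans (Nat.le_succ n) (Nat.le_mul_of_pos_right (n + 1) (by omega))

/-! ### Appended (qec-type-03 gen 5): the `X` sector

For an abelian two-block code both sectors have the same loss behaviour (`AbelianTwoBlock.xUncorrectableProb_eq`, the
`X ↔ Z` exchange is a re-indexing); `code g₁ g₂ = AbelianTwoBlock.css (binom g₁) (binom g₂)`, so every `Z`-sector loss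
threshold above is also the `X`-sector loss threshold. -/

section XSector

variable {G : Type*} [Fintype G] [AddCommGroup G] [DecidableEq G]

/-- Both sectors of a twisted toric code have the same loss-uncorrectability probability (the `X ↔ Z` exchange of the
abelian two-block code `css (binom g₁) (binom g₂)` is a re-indexing). [cite: BravyiEtAl2024, §4 Lemma 1 and its proof (H^Z = C H^X [[0,C],[C,0]])] -/
theorem xUncorrectableProb_code_eq (g₁ g₂ : G) (y : ℝ) :
    ErasureDecoder.uncorrectableProb {x : G ⊕ G → ZMod 2 | (code g₁ g₂).HZ *ᵥ x = 0}
        ((code g₁ g₂).rowSpX : Set (G ⊕ G → ZMod 2)) y =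
      ErasureDecoder.uncorrectableProb {x : G ⊕ G → ZMod 2 | (code g₁ g₂).HX *ᵥ x = 0}
        ((code g₁ g₂).rowSpZ : Set (G ⊕ G → ZMod 2)) y :=
  AbelianTwoBlock.xUncorrectableProb_eq (binom g₁) (binom g₂) y

end XSector

open Classical in
/-- **`X` sector: loss threshold EXACTLY `1/2`** for every twisted toric family with generating pair and sub-exponential
volume in the systole (the `X`-sector family IS the `Z`-sector family, `xUncorrectableProb_code_eq`).
[cite: StaceBarrettDoherty2009, p. 1 (maximum tolerable loss rate 50%), p. 2 (losses affect both logical operators alike)] -/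
theorem twistedToric_x_loss_accuracyThreshold_eq_half {Gs : ℕ → Type*} [∀ i, AddCommGroup (Gs i)]
    [∀ i, DecidableEq (Gs i)] [∀ i, Fintype (Gs i)] (g₁ g₂ : ∀ i, Gs i)
    (hgen : ∀ i (x : Gs i), ∃ m : ℤ × ℤ, m.1 • g₁ i + m.2 • g₂ i = x)
    (hgrowth : ∀ c : ℝ, 0 < c → Tendsto (fun i => (Fintype.card (Gs i) : ℝ) *
      Real.exp (-c * (((systole (g₁ i) (g₂ i) - 1) / 4 : ℕ) : ℝ))) atTop (𝓝 0)) :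
    accuracyThreshold (fun i y => ErasureDecoder.uncorrectableProb
      {x : Gs i ⊕ Gs i → ZMod 2 | (code (g₁ i) (g₂ i)).HZ *ᵥ x = 0}
      ((code (g₁ i) (g₂ i)).rowSpX : Set (Gs i ⊕ Gs i → ZMod 2)) y) = 1 / 2 := by
  have e : (fun i y => ErasureDecoder.uncorrectableProb
      {x : Gs i ⊕ Gs i → ZMod 2 | (code (g₁ i) (g₂ i)).HZ *ᵥ x = 0}
      ((code (g₁ i) (g₂ i)).rowSpX : Set (Gs i ⊕ Gs i → ZMod 2)) y) =
      (fun i y => ErasureDecoder.uncorrectableProb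
      {x : Gs i ⊕ Gs i → ZMod 2 | (code (g₁ i) (g₂ i)).HX *ᵥ x = 0}
      ((code (g₁ i) (g₂ i)).rowSpZ : Set (Gs i ⊕ Gs i → ZMod 2)) y) := by
    funext i y
    exact xUncorrectableProb_code_eq (g₁ i) (g₂ i) y
  rw [e]
  exact twistedToric_loss_accuracyThreshold_eq_half g₁ g₂ hgen hgrowth

open Classical in
/-- **`X` sector, polynomial volume**: `|G_i| ≤ A sys₁^m`, `sys₁ → ∞` ⇒ `X`-loss threshold EXACTLY `1/2`.
[cite: StaceBarrettDoherty2009, p. 1–2] [cite: KovalevPryadko2013Hyperbicycle, §IV (planar finite-rate families)] -/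
theorem twistedToric_x_loss_accuracyThreshold_eq_half_of_systole {Gs : ℕ → Type*} [∀ i, AddCommGroup (Gs i)]
    [∀ i, DecidableEq (Gs i)] [∀ i, Fintype (Gs i)] (g₁ g₂ : ∀ i, Gs i)
    (hgen : ∀ i (x : Gs i), ∃ m : ℤ × ℤ, m.1 • g₁ i + m.2 • g₂ i = x) {A : ℝ} {m : ℕ}
    (hcard : ∀ i, (Fintype.card (Gs i) : ℝ) ≤ A * (systole (g₁ i) (g₂ i) : ℝ) ^ m)
    (hsys : Tendsto (fun i => systole (g₁ i) (g₂ i)) atTop atTop) :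
    accuracyThreshold (fun i y => ErasureDecoder.uncorrectableProb
      {x : Gs i ⊕ Gs i → ZMod 2 | (code (g₁ i) (g₂ i)).HZ *ᵥ x = 0}
      ((code (g₁ i) (g₂ i)).rowSpX : Set (Gs i ⊕ Gs i → ZMod 2)) y) = 1 / 2 := by
  have e : (fun i y => ErasureDecoder.uncorrectableProb
      {x : Gs i ⊕ Gs i → ZMod 2 | (code (g₁ i) (g₂ i)).HZ *ᵥ x = 0}
      ((code (g₁ i) (g₂ i)).rowSpX : Set (Gs i ⊕ Gs i → ZMod 2)) y) =
      (fun i y => ErasureDecoder.uncorrectableProb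
      {x : Gs i ⊕ Gs i → ZMod 2 | (code (g₁ i) (g₂ i)).HX *ᵥ x = 0}
      ((code (g₁ i) (g₂ i)).rowSpZ : Set (Gs i ⊕ Gs i → ZMod 2)) y) := by
    funext i y
    exact xUncorrectableProb_code_eq (g₁ i) (g₂ i) y
  rw [e]
  exact twistedToric_loss_accuracyThreshold_eq_half_of_systole g₁ g₂ hgen hcard hsys

open Classical in
/-- **`X` sector of the rotated toric codes `[[d²+1, 2, d]]`**: loss threshold EXACTLY `1/2`.
[cite: KovalevPryadko2013Hyperbicycle, §III.B Ex. 2 ([[2t²+2(t+1)², 2, 2t+1]])] [cite: StaceBarrettDoherty2009, p. 1] -/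
theorem rotatedToric_x_loss_accuracyThreshold_eq_half :
    accuracyThreshold (fun t y => ErasureDecoder.uncorrectableProb
      {x : ZMod (2 * t ^ 2 + 2 * t + 1) ⊕ ZMod (2 * t ^ 2 + 2 * t + 1) → ZMod 2 |
        (code (((2 * t + 1 : ℕ) : ℤ) : ZMod (2 * t ^ 2 + 2 * t + 1)) 1).HZ *ᵥ x = 0}
      ((code (((2 * t + 1 : ℕ) : ℤ) : ZMod (2 * t ^ 2 + 2 * t + 1)) 1).rowSpX :
        Set (ZMod (2 * t ^ 2 + 2 * t + 1) ⊕ ZMod (2 * t ^ 2 + 2 * t + 1) → ZMod 2)) y) = 1 / 2 := by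
  have e : (fun t y => ErasureDecoder.uncorrectableProb
      {x : ZMod (2 * t ^ 2 + 2 * t + 1) ⊕ ZMod (2 * t ^ 2 + 2 * t + 1) → ZMod 2 |
        (code (((2 * t + 1 : ℕ) : ℤ) : ZMod (2 * t ^ 2 + 2 * t + 1)) 1).HZ *ᵥ x = 0}
      ((code (((2 * t + 1 : ℕ) : ℤ) : ZMod (2 * t ^ 2 + 2 * t + 1)) 1).rowSpX :
        Set (ZMod (2 * t ^ 2 + 2 * t + 1) ⊕ ZMod (2 * t ^ 2 + 2 * t + 1) → ZMod 2)) y) =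
      (fun t y => ErasureDecoder.uncorrectableProb
      {x : ZMod (2 * t ^ 2 + 2 * t + 1) ⊕ ZMod (2 * t ^ 2 + 2 * t + 1) → ZMod 2 |
        (code (((2 * t + 1 : ℕ) : ℤ) : ZMod (2 * t ^ 2 + 2 * t + 1)) 1).HX *ᵥ x = 0}
      ((code (((2 * t + 1 : ℕ) : ℤ) : ZMod (2 * t ^ 2 + 2 * t + 1)) 1).rowSpZ :
        Set (ZMod (2 * t ^ 2 + 2 * t + 1) ⊕ ZMod (2 * t ^ 2 + 2 * t + 1) → ZMod 2)) y) := by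
    funext t y
    exact xUncorrectableProb_code_eq _ _ y
  rw [e]
  exact rotatedToric_loss_accuracyThreshold_eq_half

open Classical in
/-- **`X` sector of the dilated rotated family `[[2n²c_t, 2, n(2t+1)]]`** along any `(n_i, t_i)` with `n_i(2t_i+1) → ∞`:
loss threshold EXACTLY `1/2`. [cite: KovalevPryadko2013Hyperbicycle, §IV Ex. 7 ([[2n²c, 2, nχ]])] [cite: StaceBarrettDoherty2009, p. 1] -/
theorem dilatedToric_x_loss_accuracyThreshold_eq_half (ν τ : ℕ → ℕ)
    (h : Tendsto (fun i => (ν i + 1) * (2 * τ i + 1)) atTop atTop) :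
    accuracyThreshold (fun i y => ErasureDecoder.uncorrectableProb
      {x : (ZMod (ν i + 1) × ZMod ((ν i + 1) * (2 * τ i ^ 2 + 2 * τ i + 1))) ⊕
          (ZMod (ν i + 1) × ZMod ((ν i + 1) * (2 * τ i ^ 2 + 2 * τ i + 1))) → ZMod 2 |
        (code ((1 : ZMod (ν i + 1)), ((((2 * τ i + 1 : ℕ) : ℤ)) : ZMod ((ν i + 1) * (2 * τ i ^ 2 + 2 * τ i + 1))))
          ((0 : ZMod (ν i + 1)), (1 : ZMod ((ν i + 1) * (2 * τ i ^ 2 + 2 * τ i + 1))))).HZ *ᵥ x = 0}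
      ((code ((1 : ZMod (ν i + 1)), ((((2 * τ i + 1 : ℕ) : ℤ)) : ZMod ((ν i + 1) * (2 * τ i ^ 2 + 2 * τ i + 1))))
          ((0 : ZMod (ν i + 1)), (1 : ZMod ((ν i + 1) * (2 * τ i ^ 2 + 2 * τ i + 1))))).rowSpX :
        Set ((ZMod (ν i + 1) × ZMod ((ν i + 1) * (2 * τ i ^ 2 + 2 * τ i + 1))) ⊕
          (ZMod (ν i + 1) × ZMod ((ν i + 1) * (2 * τ i ^ 2 + 2 * τ i + 1))) → ZMod 2)) y) = 1 / 2 := by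
  have e := funext fun i => funext fun y => xUncorrectableProb_code_eq
    ((1 : ZMod (ν i + 1)), ((((2 * τ i + 1 : ℕ) : ℤ)) : ZMod ((ν i + 1) * (2 * τ i ^ 2 + 2 * τ i + 1))))
    ((0 : ZMod (ν i + 1)), (1 : ZMod ((ν i + 1) * (2 * τ i ^ 2 + 2 * τ i + 1)))) y
  rw [e]
  exact dilatedToric_loss_accuracyThreshold_eq_half ν τ h

end TwistedToric

end Literature.InformationTheory.QuantumCodes
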